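import Summits.RiemannHypothesis.RiemannHypothesis.Theorems.GroundBartaGroundBartaFloorInnerPerCollar
import Summits.RiemannHypothesis.RiemannHypothesis.Theorems.GroundBartaPolarPerronFrobeniusEvenRealGroundState
import HarnessLib

/-!
# Crux `GroundBarta.GroundBartaFloor` (stmt-RiemannHypothesis-18389) — line `inner-cutoff-strong-EL`
# (part 3/3: the representative, the limit `η → 0`, Barta's inequality in moment form)

Barta's floor for the FULL windowed Weil form, by the STRONG Euler–Lagrange identity of a ground
state against the INNER smooth cut-offs of Riemann's kernel.

Let the window `a > 0` carry a ground state `u` (operator-free: `IsWeilGroundState a u`) that is real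
and `≥ 0` a.e. on `(-a, a)`; let `v ≥ 0` be its real representative (`u = v` a.e.).  For a collar
width `0 < η < a` let `θ_η` be a smooth even plateau cut-off, `θ_η = 1` on `[-(a-η), a-η]`,
`θ_η = 0` off `(-a, a)`, `0 ≤ θ_η ≤ 1`, `|θ_η'| ≤ D/η` (`stub_groundCutoff`).  Then

* the INNER PROBE `h_η = Φ θ_η` is a Weil test supported in the window, so the strong Euler–Lagrange
  identity (`IsWeilGroundState.weilFunctional_eq_energy_mul`, in tree, RH-free) gives
  `W(v ⋆ h̃_η) = ε(a) ∫ v Φ θ_η`;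
* HARMONIC SPLIT (`stub_groundHarmonicSplit`): `Φ̂ = ξ` vanishes on the zeros, so by the class
  explicit formula `W(v ⋆ h̃_η) = -W(v ⋆ κ̃_η)`, `κ_η = Φ(1 - θ_η) ≥ 0` the collar-plus-tail kernel;
* TERMWISE SIGNS for `f_η = v ⋆ κ̃_η ≥ 0` (smooth, exponential class: `stub_groundPairingClass`):
  prime term `≥ 0`; polar term `= (∫ κ_η cosh(t/2)) · (∫ v · 2cosh(t/2)) ≤ ϖ_{a-η} · C(v)`
  (`stub_groundPolar`); archimedean term (Bombieri's form) `≤ K₀ (m (m S)^{1/2})^{1/2}` with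
  `m = f_η(0) ≤ Φ(0) √(2η)` (Cauchy–Schwarz on the collar, `‖v‖₂ ≤ 1`) and `S = sup |f_η'| ≤ B/η`
  (`stub_groundArchBound`);
* `η → 0⁺`: `ε(a) ∫ vΦ ≥ -ϖ_a C(v)`, and `Φ(a) C(v) ≤ 2cosh(a/2) ∫ vΦ`, `∫ vΦ > 0` give
  `ε(a) ≥ -e(a)`, `e(a) = 2ϖ_a cosh(a/2)/Φ(a) = groundBartaRate a → 0` (`stub_groundRateDecay`,
  LANDED in `GroundBartaGroundBartaFloorRateDecay`).

No outer cut-off, no window-continuity of `ε`, no minimising sequence is used.  The five stubs of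
the line (`stub_groundCutoff`, `stub_groundPairingClass`, `stub_groundHarmonicSplit`,
`stub_groundPolar`, `stub_groundArchBound`) and the rate `stub_groundRateDecay` are LANDED in the
sibling `GroundBartaGroundBartaFloorInner*.lean` / `…RateDecay.lean` files; this file is the
sorry-free composition in MOMENT FORM (`ic_barta_moment_inequality`), a SECOND, independent derivation of the
floor (the crux itself was landed first by prover A's outer-cutoff line, `Theorems/GroundBartaGroundBartaFloor.lean`).
Prover B, speedrun unit `sr-gb-rung-b`.
-/

set_option linter.dupNamespace false

noncomputable section

open Set MeasureTheory Filter Complex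
open scoped Real Topology ComplexConjugate

namespace Summit.RiemannHypothesis.RiemannHypothesis.Theorems.GroundBartaFloor

open Literature.NumberTheory.LFunctions
open Summit.RiemannHypothesis.RiemannHypothesis.Theorems.GroundStatesConvergeToXi

/-! The five stubs of the line are LANDED (prover B, `--as helper` on the item):
`stub_groundCutoff` (…InnerCutoff), `stub_groundPairingClass`, `stub_groundPolar` (…InnerPairing),
`stub_groundHarmonicSplit` (…InnerSplit), `stub_groundArchBound` (…InnerArchBound); the rate
`stub_groundRateDecay` is prover −2's (…RateDecay). -/

/-! ## Barta's inequality at a good window -/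

/-- The non-negative real representative of a one-signed ground state: `u = v` a.e. with
`v ≥ 0` measurable, vanishing off `(-a, a)`, integrable, `∫ v² ≤ 1`. -/
theorem ic_representative {a : ℝ} {u : ℝ → ℂ} (hu : IsWeilGroundState a u)
    (hsign : ∀ᵐ t : ℝ, t ∈ Ioo (-a) a → (u t).im = 0 ∧ 0 ≤ (u t).re) :
    ∃ v : ℝ → ℝ, Measurable v ∧ (∀ t, 0 ≤ v t) ∧ (∀ t, t ∉ Ioo (-a) a → v t = 0) ∧ Integrable v ∧
      Integrable (fun t => v t ^ 2) ∧ ∫ t, v t ^ 2 ≤ 1 ∧ u =ᵐ[volume] fun t => ((v t : ℝ) : ℂ) := by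
  have hum : AEStronglyMeasurable u volume := hu.memLp.1
  set u' : ℝ → ℂ := hum.mk u with hu'def
  have hu'm : StronglyMeasurable u' := hum.stronglyMeasurable_mk
  have huu' : u =ᵐ[volume] u' := hum.ae_eq_mk
  set v : ℝ → ℝ := (Ioo (-a) a).indicator fun t => max (u' t).re 0 with hv
  have hvm : Measurable v :=
    ((Complex.measurable_re.comp hu'm.measurable).max measurable_const).indicator measurableSet_Ioo
  have hv0 : ∀ t, 0 ≤ v t := fun t => by
    by_cases ht : t ∈ Ioo (-a) a
    · simp only [hv, indicator_of_mem ht]; exact le_max_right _ _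
    · simp only [hv, indicator_of_notMem ht]; exact le_rfl
  have hvs : ∀ t, t ∉ Ioo (-a) a → v t = 0 := fun t ht => by
    simp only [hv, indicator_of_notMem ht]
  have hv_le : ∀ t, |v t| ≤ ‖u' t‖ := fun t => by
    by_cases ht : t ∈ Ioo (-a) a
    · simp only [hv, indicator_of_mem ht]
      rw [abs_of_nonneg (le_max_right _ _)]
      exact max_le (Complex.re_le_norm _) (norm_nonneg _)
    · simp only [hv, indicator_of_notMem ht, abs_zero]; exact norm_nonneg _
  have hu'i : Integrable u' := hu.integrable.congr huu'
  have hvi : Integrable v := hu'i.norm.mono' hvm.aestronglyMeasurable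
    (ae_of_all _ fun t => by rw [Real.norm_eq_abs]; exact hv_le t)
  have hu'2 : Integrable (fun t => ‖u' t‖ ^ 2) :=
    (memLp_two_iff_integrable_sq_norm hu'm.aestronglyMeasurable).1 (hu.memLp.ae_eq huu')
  have hvsq_le : ∀ t, v t ^ 2 ≤ ‖u' t‖ ^ 2 := fun t => by
    rw [← sq_abs]; exact pow_le_pow_left₀ (abs_nonneg _) (hv_le t) 2
  have hv2 : Integrable (fun t => v t ^ 2) :=
    hu'2.mono' (hvm.pow_const 2).aestronglyMeasurable (ae_of_all _ fun t => by
      rw [Real.norm_eq_abs, abs_of_nonneg (sq_nonneg _)]; exact hvsq_le t)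
  have hv21 : ∫ t, v t ^ 2 ≤ 1 := by
    calc ∫ t, v t ^ 2 ≤ ∫ t, ‖u' t‖ ^ 2 := integral_mono hv2 hu'2 hvsq_le
      _ = ∫ t, ‖u t‖ ^ 2 := integral_congr_ae (huu'.mono fun t ht => by simp [ht])
      _ = 1 := hu.integral_norm_sq
  have hnull : (volume : Measure ℝ) {-a, a} = 0 := (Set.toFinite _).measure_zero volume
  have hae2 := measure_eq_zero_iff_ae_notMem.1 hnull
  have hIoo_of : ∀ t : ℝ, t ∉ ({-a, a} : Set ℝ) → t ∈ Icc (-a) a → t ∈ Ioo (-a) a := by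
    intro t ht hm
    simp only [mem_insert_iff, mem_singleton_iff, not_or] at ht
    exact ⟨lt_of_le_of_ne hm.1 (fun h => ht.1 h.symm), lt_of_le_of_ne hm.2 (fun h => ht.2 h)⟩
  have hae : u =ᵐ[volume] fun t => ((v t : ℝ) : ℂ) := by
    filter_upwards [hsign, hu.ae_eq_zero_of_notMem, hae2, huu'] with t h1 h2 h3 h4
    by_cases ht : t ∈ Ioo (-a) a
    · obtain ⟨him, hre⟩ := h1 ht
      simp only [hv, indicator_of_mem ht, ← h4, max_eq_left hre]
      exact Complex.ext (by simp) (by simp [him])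
    · have hm : t ∉ Icc (-a) a := fun hm => ht (hIoo_of t h3 hm)
      simp only [hv, indicator_of_notMem ht, h2 hm, Complex.ofReal_zero]
  exact ⟨v, hvm, hv0, hvs, hvi, hv2, hv21, hae⟩

/-- **Barta's inequality in MOMENT FORM at a good window (inner-cutoff line).**  If the window
`a > 0` carries a ground state `u` with `Im u = 0`, `Re u ≥ 0` a.e. on `(-a, a)`, and `v ≥ 0` is its
real representative, then `∫ vΦ > 0` and
`ε(a) · ∫ vΦ ≥ -ϖ_a · ∫ v · 2cosh(t/2) ≥ -e(a) · ∫ vΦ`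
(`ϖ_a = groundThetaPolarWeight a`, `e(a) = groundBartaRate a`): the limit `η → 0⁺` of the per-collar
inequalities — sharper than the floor `ε(a) ≥ -e(a)` it implies (the crux, landed by prover A as
`GroundBartaFloor_of` / `neg_groundBartaRate_le_weilGroundEnergy` on the outer-cutoff line). -/
theorem ic_barta_moment_inequality {a : ℝ} (ha : 0 < a) {u : ℝ → ℂ}
    (hu : IsWeilGroundState a u)
    (hsign : ∀ᵐ t : ℝ, t ∈ Ioo (-a) a → (u t).im = 0 ∧ 0 ≤ (u t).re) :
    ∃ v : ℝ → ℝ, (∀ t, 0 ≤ v t) ∧ (u =ᵐ[volume] fun t => ((v t : ℝ) : ℂ)) ∧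
      0 < ∫ t, v t * weilThetaPhi t ∧
      -(groundThetaPolarWeight a * ∫ t, v t * (2 * Real.cosh (t / 2))) ≤
        weilGroundEnergy a * ∫ t, v t * weilThetaPhi t ∧
      -groundBartaRate a * ∫ t, v t * weilThetaPhi t ≤ weilGroundEnergy a * ∫ t, v t * weilThetaPhi t := by
  obtain ⟨v, hv, hv0, hvs, hvi, hv2, hv21, hae⟩ := ic_representative hu hsign
  have hvG : IsWeilGroundState a (fun t => ((v t : ℝ) : ℂ)) := hu.congr_ae hae
  obtain ⟨D, hD, hcut⟩ := stub_groundCutoff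
  obtain ⟨K₀, hK₀, hK⟩ := stub_groundArchBound
  obtain ⟨M, hM, hM'⟩ := ic_exists_abs_deriv_weilThetaPhi_le
  have hΦ0 := weilThetaPhi_pos 0
  have hvsIcc : ∀ t, t ∉ Icc (-a) a → v t = 0 := fun t ht =>
    hvs t fun h => ht (Ioo_subset_Icc_self h)
  /- the two moments of `v` -/
  set p : ℝ := ∫ t, v t * weilThetaPhi t with hp
  set cv : ℝ := ∫ t, v t * (2 * Real.cosh (t / 2)) with hcv
  have hcosh_le : ∀ t ∈ Icc (-a) a, Real.cosh (t / 2) ≤ Real.cosh (a / 2) := fun t ht => by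
    rw [Real.cosh_le_cosh, abs_div, abs_div, abs_two, abs_of_pos ha]
    exact div_le_div_of_nonneg_right (abs_le.2 ⟨ht.1, ht.2⟩) zero_le_two
  have hvΦ_int : Integrable fun t => v t * weilThetaPhi t := by
    refine Integrable.mono' (hvi.norm.mul_const (weilThetaPhi 0))
      (hv.aestronglyMeasurable.mul continuous_weilThetaPhi.aestronglyMeasurable)
      (Eventually.of_forall fun t => ?_)
    rw [Real.norm_eq_abs, abs_mul, Real.norm_eq_abs, abs_of_pos (weilThetaPhi_pos t)]
    exact mul_le_mul_of_nonneg_left (gbf_weilThetaPhi_le_zero_val t) (abs_nonneg _)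
  have hvc_int : Integrable fun t => v t * (2 * Real.cosh (t / 2)) := by
    refine Integrable.mono' (hvi.norm.mul_const (2 * Real.cosh (a / 2)))
      (hv.aestronglyMeasurable.mul (by fun_prop : Continuous fun t : ℝ => 2 * Real.cosh (t / 2)).aestronglyMeasurable)
      (Eventually.of_forall fun t => ?_)
    rw [Real.norm_eq_abs, abs_mul, Real.norm_eq_abs,
      abs_of_pos (mul_pos two_pos (Real.cosh_pos _))]
    by_cases ht : t ∈ Icc (-a) a
    · exact mul_le_mul_of_nonneg_left (by linarith [hcosh_le t ht]) (abs_nonneg _)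
    · rw [hvsIcc t ht, abs_zero, zero_mul, zero_mul]
  -- `p > 0`
  have hp_pos : 0 < p := by
    have hnn : ∀ t, 0 ≤ v t * weilThetaPhi t := fun t => mul_nonneg (hv0 t) (weilThetaPhi_pos t).le
    have hI : 0 ≤ ∫ t, v t * weilThetaPhi t := integral_nonneg fun t => hnn t
    rcases hI.eq_or_lt with hz | hz'
    · exfalso
      have hvΦ0 : (fun t => v t * weilThetaPhi t) =ᵐ[volume] 0 :=
        (integral_eq_zero_iff_of_nonneg hnn hvΦ_int).1 hz.symm
      have hu0 : ∀ᵐ t : ℝ, u t = 0 := by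
        filter_upwards [hvΦ0, hae] with t h0 h1
        simp only [Pi.zero_apply, mul_eq_zero, (weilThetaPhi_pos t).ne', or_false] at h0
        rw [h1]
        simp only [h0, Complex.ofReal_zero]
      have : ∫ t, ‖u t‖ ^ 2 = 0 := by
        rw [← integral_zero (α := ℝ)]
        exact integral_congr_ae (hu0.mono fun t ht => by simp [ht])
      linarith [hu.integral_norm_sq]
    · exact hz'
  -- `Φ(a) cv ≤ 2cosh(a/2) p`
  have hcp : weilThetaPhi a * cv ≤ 2 * Real.cosh (a / 2) * p := by
    rw [hcv, hp, ← integral_const_mul, ← integral_const_mul]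
    refine integral_mono (hvc_int.const_mul _) (hvΦ_int.const_mul _) fun t => ?_
    dsimp only
    by_cases ht : t ∈ Icc (-a) a
    · have h1 : weilThetaPhi a ≤ weilThetaPhi t := gbf_weilThetaPhi_le_of_abs_le (abs_le.2 ⟨ht.1, ht.2⟩)
      have h2 := hcosh_le t ht
      calc weilThetaPhi a * (v t * (2 * Real.cosh (t / 2)))
          = 2 * v t * (weilThetaPhi a * Real.cosh (t / 2)) := by ring
        _ ≤ 2 * v t * (weilThetaPhi t * Real.cosh (a / 2)) :=
          mul_le_mul_of_nonneg_left (mul_le_mul h1 h2 (Real.cosh_pos _).le (weilThetaPhi_pos t).le)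
            (mul_nonneg zero_le_two (hv0 t))
        _ = 2 * Real.cosh (a / 2) * (v t * weilThetaPhi t) := by ring
    · rw [hvsIcc t ht]; simp
  /- the collars `η_m → 0⁺` and their cut-offs -/
  set η : ℕ → ℝ := fun m => min 1 (a / 2) / ((m : ℝ) + 2) with hηdef
  have hmin : 0 < min 1 (a / 2) := lt_min one_pos (by linarith)
  have hη0 : ∀ m, 0 < η m := fun m => by positivity
  have hηle : ∀ m, η m ≤ min 1 (a / 2) / 2 := fun m => by
    simp only [hηdef]
    exact div_le_div_of_nonneg_left hmin.le two_pos (by linarith [(Nat.cast_nonneg m : (0 : ℝ) ≤ m)])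
  have hη1 : ∀ m, η m ≤ 1 := fun m => (hηle m).trans (by linarith [min_le_left (1 : ℝ) (a / 2)])
  have hηa : ∀ m, η m < a := fun m => (hηle m).trans_lt (by linarith [min_le_right (1 : ℝ) (a / 2)])
  have hηlim : Tendsto η atTop (𝓝 0) := by
    have h1 : Tendsto (fun m : ℕ => ((m : ℝ) + 2)) atTop atTop :=
      tendsto_atTop_add_const_right _ _ tendsto_natCast_atTop_atTop
    have h2 := h1.inv_tendsto_atTop.const_mul (min 1 (a / 2))
    rw [mul_zero] at h2
    exact h2.congr fun m => by simp only [hηdef, Pi.inv_apply, div_eq_mul_inv]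
  have hθex : ∀ m, ∃ θ : ℝ → ℝ, ContDiff ℝ (⊤ : ℕ∞) θ ∧ (∀ t, |t| ≤ a - η m → θ t = 1) ∧
      (∀ t, a ≤ |t| → θ t = 0) ∧ (∀ t, 0 ≤ θ t) ∧ (∀ t, θ t ≤ 1) ∧ (∀ t, θ (-t) = θ t) ∧
      (∀ t, |deriv θ t| ≤ D / η m) := fun m => hcut a (η m) (hη0 m) (hηa m)
  choose θ hθc hθ1 hθ0 hθnn hθle hθe hθd using hθex
  /- the per-collar inequalities -/
  set α : ℝ := 2 * weilThetaPhi 0 with hα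
  set β : ℝ := (M + weilThetaPhi 0 * D) * ∫ t, v t with hβ
  have hper : ∀ m, -(groundThetaPolarWeight (a - η m) * cv +
      K₀ * Real.sqrt (α * Real.sqrt (α * β) * Real.sqrt (Real.sqrt (η m)))) ≤
      weilGroundEnergy a * ∫ t, v t * (weilThetaPhi t * θ m t) := fun m =>
    ic_perCollar (hη0 m) (hη1 m) hv hv0 hvs hvi hv2 hv21 hvG (hθc m) (hθ1 m) (hθ0 m)
      (fun t => ⟨hθnn m t, hθle m t⟩) (hθe m) hD (hθd m) hK₀ hK hM hM'
  /- the limits `m → ∞` -/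
  have hlimP : Tendsto (fun m => ∫ t, v t * (weilThetaPhi t * θ m t)) atTop (𝓝 p) := by
    refine tendsto_integral_of_dominated_convergence (fun t => v t * weilThetaPhi t)
      (fun m => (hv.mul (continuous_weilThetaPhi.mul (hθc m).continuous).measurable).aestronglyMeasurable)
      hvΦ_int (fun m => ae_of_all _ fun t => ?_) (ae_of_all _ fun t => ?_)
    · rw [Real.norm_eq_abs, abs_mul, abs_mul, abs_of_nonneg (hv0 t), abs_of_pos (weilThetaPhi_pos t),
        abs_of_nonneg (hθnn m t)]
      exact mul_le_mul_of_nonneg_left (mul_le_of_le_one_right (weilThetaPhi_pos t).le (hθle m t)) (hv0 t)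
    · by_cases ht : t ∈ Ioo (-a) a
      · have hgap : 0 < a - |t| := by
          have : |t| < a := abs_lt.2 ⟨ht.1, ht.2⟩
          linarith
        have hev : ∀ᶠ m in atTop, η m < a - |t| := hηlim.eventually (gt_mem_nhds hgap)
        refine (tendsto_const_nhds (x := v t * weilThetaPhi t)).congr' ?_
        filter_upwards [hev] with m hm
        rw [hθ1 m t (by linarith), mul_one]
      · simp only [hvs t ht, zero_mul]
        exact tendsto_const_nhds
  have hlimW : Tendsto (fun m => groundThetaPolarWeight (a - η m)) atTop
      (𝓝 (groundThetaPolarWeight a)) := ic_tendsto_polarWeight hηlim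
  have hlimE : Tendsto (fun m => K₀ * Real.sqrt (α * Real.sqrt (α * β) * Real.sqrt (Real.sqrt (η m))))
      atTop (𝓝 0) := by
    have h1 : Tendsto (fun m => Real.sqrt (Real.sqrt (η m))) atTop (𝓝 0) := by
      have := (hηlim.sqrt).sqrt
      simpa using this
    have h2 := ((h1.const_mul (α * Real.sqrt (α * β))).sqrt).const_mul K₀
    simpa using h2
  have hfinal : -(groundThetaPolarWeight a * cv) ≤ weilGroundEnergy a * p := by
    refine le_of_tendsto_of_tendsto' ?_ (hlimP.const_mul (weilGroundEnergy a)) hper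
    have h := (hlimW.mul_const cv).add hlimE
    rw [add_zero] at h
    exact h.neg
  /- algebra: `ε p ≥ -ϖ_a cv ≥ -e(a) p` -/
  have hΦa := weilThetaPhi_pos a
  have hϖ := groundThetaPolarWeight_nonneg a
  have h1 : cv ≤ 2 * Real.cosh (a / 2) * p / weilThetaPhi a := by
    rw [le_div_iff₀ hΦa]; linarith
  have h2 : groundThetaPolarWeight a * cv ≤ groundBartaRate a * p := by
    have : groundThetaPolarWeight a * cv ≤
        groundThetaPolarWeight a * (2 * Real.cosh (a / 2) * p / weilThetaPhi a) :=
      mul_le_mul_of_nonneg_left h1 hϖ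
    refine this.trans (le_of_eq ?_)
    rw [groundBartaRate_def]
    field_simp
  have h3 : -groundBartaRate a * p ≤ weilGroundEnergy a * p := by linarith
  exact ⟨v, hv0, hae, hp_pos, hfinal, h3⟩

/-! The crux `GroundBarta.GroundBartaFloor` itself follows from `ic_barta_moment_inequality` (last
conjunct, divided by `∫ vΦ > 0`), `stub_groundRateDecay` and the sphere bound exactly as in prover A's
landed `GroundBartaFloor_of` (`Theorems/GroundBartaGroundBartaFloor.lean`); it is not re-declared here
(one statement, one module). -/

end Summit.RiemannHypothesis.RiemannHypothesis.Theorems.GroundBartaFloor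

end
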